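import Summits.NavierStokesRegularity.NavierStokesRegularity.Theorems.ArgmaxDoorsGrowth
import Summits.NavierStokesRegularity.NavierStokesRegularity.Theorems.ArgmaxDoorsDefs
import Literature.Analysis.FluidPDE.ClassicalSolutionGlue
import HarnessLib

/-!
# ArgmaxDoorsThreshold — door S35-B «ArgmaxSubcriticalDoor» CLOSED through the THRESHOLD engine
# (second, independent route: no phase lemma Φ, no sup-norm continuity)

Summits-side proof file (theorems only). Texts of record: nsreg-p1 g29 `r33/Sketch35.lean` v3 sha16
93168f45ce53c5c4 = tree P0 `Theorems/ArgmaxDoorsDefs.lean`. The planner's route of record for door B is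
E + Φ + F (`argmaxSubcriticalDoor_of_plates`); this file is the LEAD's "welcome second closer" (STATUS
15:22:50Z (2)) and the first consumer of the supersolution form of the engine
(`ArgmaxDoorsGrowth.norm_curl_le_supersolution_of_argmax_rate_le`).

* `argmaxSubcriticalDoor_of_threshold : TypeISmallFloor → ArgmaxSubcriticalDoor` — with `M₀ = ‖ω(t₀)‖_∞`,
  `c = M₀(T−t₀)^a`, the barrier `B(t) = ε/(T−t) + c(T−t)^{−a}` is a supersolution of `y' = (a/(T−t))y`
  (`B' − (a/(T−t))B = (1−a)ε/(T−t)² ≥ 0`), `B(t₀) ≥ M₀`, and `|ω(x̄,t)| > B(t)` forces `(T−t)|ω(x̄,t)| > ε`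
  where the door hypothesis gives the rate `a/(T−t)`; hence `(T−t)‖ω(t)‖_∞ ≤ ε + c(T−t)^{1−a}`, which is
  `≤ (ε + √3/4)/2 < √3/4` on a final interval, and the floor F applies;
* `argmaxSubcriticalDoor_holds_of_threshold : ArgmaxSubcriticalDoor` (F = P0's `typeISmallFloor_holds`).

HONEST FRAME / WHAT THIS IS NOT: a regularity CRITERION about hypothetical blow-up (a-posteriori Type-I small
via the barrier, then the S33 floor); item 0056 `NoTypeII` and NS regularity are NOT proved; no Literature
fact is taken as a hypothesis; `--supports stmt-NavierStokesRegularity-0056 --as helper`.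
-/

noncomputable section

set_option linter.dupNamespace false

open MeasureTheory Set Function Filter Metric Real InnerProductSpace
open _root_.Topology
open scoped ENNReal NNReal RealInnerProductSpace ContDiff Laplacian
open Literature.Analysis Literature.Analysis.FluidPDE
open Literature.Analysis.FluidPDE.VorticityDirectionDynamics

namespace Summit.NavierStokesRegularity.NavierStokesRegularity.Theorems.ArgmaxDoors

-- nested operator types (second derivatives)
set_option maxSynthPendingDepth 3

/-- **Door S35-B through the THRESHOLD engine (second route, no phase lemma, no sup-norm continuity):**
`TypeISmallFloor → ArgmaxSubcriticalDoor`. With `M₀ = ‖ω(t₀)‖_∞`, `c = M₀(T−t₀)^a`, the barrier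
`B(t) = ε/(T−t) + c(T−t)^{−a}` is a supersolution of `y' = (a/(T−t))y` (`B' − (a/(T−t))B =
(1−a)ε/(T−t)² ≥ 0`, any `a ≤ 1`), `B(t₀) ≥ M₀`, and `|ω(x̄,t)| > B(t)` forces `(T−t)|ω(x̄,t)| > ε`, where the
door hypothesis gives the rate `a/(T−t)`; so `norm_curl_le_supersolution_of_argmax_rate_le` (time-translated)
yields `(T−t)‖ω(t)‖_∞ ≤ ε + c(T−t)^{1−a} → ε < √3/4`, and the floor F applies on a final interval. [folklore] -/
theorem argmaxSubcriticalDoor_of_threshold (hF : TypeISmallFloor) : ArgmaxSubcriticalDoor := by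
  intro ν T t₀ a ε hν ht₀ ht₀T ha hε hε' u p hsol hreg hhyp
  have hTt₀ : 0 < T - t₀ := sub_pos.2 ht₀T
  set M₀ : ℝ := supVorticity u t₀ with hM₀
  have hM₀0 : 0 ≤ M₀ := supVorticity_nonneg u t₀
  set c : ℝ := M₀ * (T - t₀) ^ a with hc
  have hc0 : 0 ≤ c := mul_nonneg hM₀0 (Real.rpow_nonneg hTt₀.le a)
  -- ### the barrier bound on `[t₀, T)`
  have hbound : ∀ t ∈ Ico t₀ T, ∀ x, ‖curl (u t) x‖ ≤ ε / (T - t) + c * (T - t) ^ (-a) := by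
    intro t ht x
    -- a closed slab `[t₀, T'']` containing `t`, translated to `[0, L]`
    set T'' : ℝ := (t + T) / 2 with hT''def
    have htT'' : t ≤ T'' := by rw [hT''def]; linarith [ht.2]
    have hT''T : T'' < T := by rw [hT''def]; linarith [ht.2]
    have ht₀T'' : t₀ < T'' := by rw [hT''def]; linarith [ht.1, ht.2]
    set L : ℝ := T'' - t₀ with hLdef
    have hL : 0 < L := by rw [hLdef]; linarith
    set v : ℝ → (EuclideanSpace ℝ (Fin 3)) → (EuclideanSpace ℝ (Fin 3)) := fun s => u (s + t₀) with hv
    set q : ℝ → (EuclideanSpace ℝ (Fin 3)) → ℝ := fun s => p (s + t₀) with hq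
    have hS : IsClassicalNSSolutionOn (Icc 0 L) ν 0 v q :=
      (hsol.translate_Ico_zero ht₀).mono (fun s hs => ⟨hs.1, by rw [hLdef] at hs; linarith [hs.2]⟩)
        (uniqueDiffOn_Icc hL)
    have hB : HasBoundedSobolevNormsOn (Icc 0 L) v := by
      intro n
      obtain ⟨C', hC'⟩ := hreg T'' hT''T n
      exact ⟨C', fun s hs => hC' (s + t₀) ⟨by linarith [hs.1], by rw [hLdef] at hs; linarith [hs.2]⟩⟩
    -- `τ(s) = T − t₀ − s > 0` on the slab
    have hτ : ∀ s ∈ Icc (0 : ℝ) L, 0 < T - t₀ - s := fun s hs => by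
      rw [hLdef] at hs; linarith [hs.2]
    -- the barrier, its derivative, the rate
    set Bf : ℝ → ℝ := fun s => ε / (T - t₀ - s) + c * (T - t₀ - s) ^ (-a) with hBf
    set Bf' : ℝ → ℝ := fun s => ε / (T - t₀ - s) ^ 2 + c * (a * (T - t₀ - s) ^ (-a - 1)) with hBf'
    set φ : ℝ → ℝ := fun s => a / (T - t₀ - s) with hφ
    have hBc : ContinuousOn Bf (Icc 0 L) := by
      have h1 : ContinuousOn (fun s : ℝ => T - t₀ - s) (Icc 0 L) :=
        (continuousOn_const.sub continuousOn_id)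
      refine (continuousOn_const.div h1 fun s hs => (hτ s hs).ne').add
        (continuousOn_const.mul (h1.rpow_const fun s hs => Or.inl (hτ s hs).ne'))
    have hBpos : ∀ s ∈ Icc 0 L, 0 < Bf s := fun s hs =>
      add_pos_of_pos_of_nonneg (div_pos hε (hτ s hs)) (mul_nonneg hc0 (Real.rpow_nonneg (hτ s hs).le _))
    have hBd : ∀ s ∈ Icc 0 L, HasDerivWithinAt Bf (Bf' s) (Icc 0 L) s := by
      intro s hs
      have hτs := hτ s hs
      have hlin : HasDerivAt (fun r : ℝ => T - t₀ - r) (-1) s := by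
        simpa using (hasDerivAt_id s).const_sub (T - t₀)
      have h1 : HasDerivAt (fun r : ℝ => ε / (T - t₀ - r)) (ε / (T - t₀ - s) ^ 2) s := by
        have h := (hlin.inv hτs.ne').const_mul ε
        refine h.congr_of_eventuallyEq (Eventually.of_forall fun r => by simp [div_eq_mul_inv]) |>.congr_deriv ?_
        field_simp
      have h2 : HasDerivAt (fun r : ℝ => c * (T - t₀ - r) ^ (-a)) (c * (a * (T - t₀ - s) ^ (-a - 1))) s := by
        have h := (hlin.rpow_const (p := -a) (Or.inl hτs.ne')).const_mul c
        refine h.congr_deriv ?_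
        ring
      exact (h1.add h2).hasDerivWithinAt
    have hsuper : ∀ s ∈ Icc 0 L, φ s * Bf s ≤ Bf' s := by
      intro s hs
      have hτs := hτ s hs
      simp only [hφ, hBf, hBf']
      have hr : (T - t₀ - s) ^ (-a - 1) = (T - t₀ - s) ^ (-a) * (T - t₀ - s)⁻¹ := by
        rw [Real.rpow_sub hτs, Real.rpow_one, div_eq_mul_inv]
      rw [hr]
      have hpow : 0 ≤ c * (T - t₀ - s) ^ (-a) := mul_nonneg hc0 (Real.rpow_nonneg hτs.le _)
      have hkey : a / (T - t₀ - s) * (ε / (T - t₀ - s)) ≤ ε / (T - t₀ - s) ^ 2 := by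
        rw [div_mul_div_comm, ← sq, div_le_div_iff_of_pos_right (by positivity)]
        nlinarith
      have heq : a / (T - t₀ - s) * (c * (T - t₀ - s) ^ (-a)) =
          c * (a * ((T - t₀ - s) ^ (-a) * (T - t₀ - s)⁻¹)) := by
        rw [div_eq_mul_inv]; ring
      rw [mul_add, heq]
      linarith
    have hrate : ∀ s ∈ Icc 0 L, 0 < s → ∀ x₀ : EuclideanSpace ℝ (Fin 3),
        (∀ y, ‖curl (v s) y‖ ≤ ‖curl (v s) x₀‖) → Bf s < ‖curl (v s) x₀‖ →
        ⟪vorticityDirection (curl (v s)) x₀, fderiv ℝ (v s) x₀ (vorticityDirection (curl (v s)) x₀)⟫ -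
            ν * frobeniusNormSq (fderiv ℝ (vorticityDirection (curl (v s))) x₀) ≤ φ s := by
      intro s hs hspos x₀ hmax hbig
      have hτs := hτ s hs
      have hst : s + t₀ ∈ Ico t₀ T := ⟨by linarith, by rw [hLdef] at hs; linarith [hs.2]⟩
      have hTT : T - (s + t₀) = T - t₀ - s := by ring
      have hx0 : curl (u (s + t₀)) x₀ ≠ 0 := by
        intro h0
        have : ‖curl (v s) x₀‖ = 0 := by simp only [hv, h0, norm_zero]
        linarith [hBpos s hs]
      have hεlt : ε < (T - (s + t₀)) * ‖curl (u (s + t₀)) x₀‖ := by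
        rw [hTT]
        have h1 : ε / (T - t₀ - s) ≤ Bf s := le_add_of_nonneg_right (mul_nonneg hc0 (Real.rpow_nonneg hτs.le _))
        have h2 : ε / (T - t₀ - s) < ‖curl (v s) x₀‖ := h1.trans_lt hbig
        rw [div_lt_iff₀ hτs] at h2
        simpa [hv, mul_comm] using h2
      have hB' := hhyp (s + t₀) hst x₀ hmax hεlt
      -- `(T - t) netStretch ≤ a |ω|²` ⇒ rate `≤ a/(T−t)`
      have hr := rate_le_of_netStretch_le hx0 (c := a / (T - (s + t₀))) (by
        rw [div_mul_eq_mul_div, le_div_iff₀ (by rw [hTT]; exact hτs), mul_comm]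
        exact hB')
      simp only [hφ, hv, ← hTT]
      exact hr
    have hM : ∀ x, ‖curl (v 0) x‖ ≤ Bf 0 := by
      intro x
      have h1 : ‖curl (u t₀) x‖ ≤ M₀ := norm_curl_le_supVorticity hsol hreg ⟨ht₀, ht₀T⟩ x
      have h2 : Bf 0 = ε / (T - t₀) + M₀ := by
        simp only [hBf, sub_zero, hc]
        rw [mul_assoc, ← Real.rpow_add hTt₀, add_neg_cancel, Real.rpow_zero, mul_one]
      have h3 : 0 ≤ ε / (T - t₀) := (div_pos hε hTt₀).le
      simp only [hv, zero_add]
      linarith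
    have hmain := norm_curl_le_supersolution_of_argmax_rate_le hν hL hS hB hBc hBpos hBd hsuper hrate hM
    have hs : t - t₀ ∈ Icc 0 L := ⟨by linarith [ht.1], by rw [hLdef]; linarith⟩
    have h := hmain (t - t₀) hs x
    have hTT : T - t₀ - (t - t₀) = T - t := by ring
    simp only [hv, hBf, sub_add_cancel, hTT] at h
    exact h
  -- ### the phase `(T − t)‖ω(t)‖_∞ ≤ ε + c (T − t)^{1−a}` and the final interval
  have hphase : ∀ t ∈ Ico t₀ T, (T - t) * supVorticity u t ≤ ε + c * (T - t) ^ (1 - a) := by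
    intro t ht
    have hTt : 0 < T - t := sub_pos.2 ht.2
    have hb0 : 0 ≤ ε / (T - t) + c * (T - t) ^ (-a) :=
      add_nonneg (div_pos hε hTt).le (mul_nonneg hc0 (Real.rpow_nonneg hTt.le _))
    have hsup : supVorticity u t ≤ ε / (T - t) + c * (T - t) ^ (-a) :=
      supVorticity_le_of_forall_le hb0 (hbound t ht)
    have heq : (T - t) * (ε / (T - t) + c * (T - t) ^ (-a)) = ε + c * (T - t) ^ (1 - a) := by
      rw [mul_add, mul_div_cancel₀ _ hTt.ne', Real.rpow_sub hTt, Real.rpow_one, Real.rpow_neg hTt.le]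
      field_simp
    calc (T - t) * supVorticity u t ≤ (T - t) * (ε / (T - t) + c * (T - t) ^ (-a)) :=
          mul_le_mul_of_nonneg_left hsup hTt.le
      _ = ε + c * (T - t) ^ (1 - a) := heq
  set gap : ℝ := Real.sqrt 3 / 4 - ε with hgap
  have hgap0 : 0 < gap := by rw [hgap]; linarith
  have h1a : 0 < 1 - a := by linarith
  set qq : ℝ := gap / 2 / (c + 1) with hqq
  have hqq0 : 0 < qq := by positivity
  set δ : ℝ := qq ^ (1 / (1 - a)) with hδ
  have hδ0 : 0 < δ := Real.rpow_pos_of_pos hqq0 _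
  have hδpow : δ ^ (1 - a) = qq := by
    rw [hδ, ← Real.rpow_mul hqq0.le, one_div_mul_cancel h1a.ne', Real.rpow_one]
  set t₁ : ℝ := max t₀ (T - δ) with ht₁
  have ht₁mem : t₁ ∈ Ico t₀ T := ⟨le_max_left _ _, max_lt ht₀T (by linarith)⟩
  have hsmall : ∀ t ∈ Ico t₁ T, (T - t) * supVorticity u t ≤ ε + gap / 2 := by
    intro t ht
    have htt₀ : t ∈ Ico t₀ T := ⟨(le_max_left _ _).trans ht.1, ht.2⟩
    have hTt : 0 < T - t := sub_pos.2 ht.2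
    have hle : T - t ≤ δ := by linarith [le_max_right t₀ (T - δ), ht.1]
    have hpow : (T - t) ^ (1 - a) ≤ qq := by
      rw [← hδpow]; exact Real.rpow_le_rpow hTt.le hle h1a.le
    have hcq : c * (T - t) ^ (1 - a) ≤ gap / 2 := by
      calc c * (T - t) ^ (1 - a) ≤ c * qq := mul_le_mul_of_nonneg_left hpow hc0
        _ ≤ (c + 1) * qq := mul_le_mul_of_nonneg_right (by linarith) hqq0.le
        _ = gap / 2 := by rw [hqq]; field_simp
    linarith [hphase t htt₀]
  exact hF ν T t₁ (ε + gap / 2) hν (ht₀.trans ht₁mem.1) ht₁mem.2 (by positivity)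
    (by rw [hgap]; linarith) u p hsol hreg hsmall

/-- **Door S35-B «ArgmaxSubcriticalDoor» CLOSED through the threshold engine** (F from P0's
`typeISmallFloor_holds`). [folklore] -/
theorem argmaxSubcriticalDoor_holds_of_threshold : ArgmaxSubcriticalDoor :=
  argmaxSubcriticalDoor_of_threshold typeISmallFloor_holds

end Summit.NavierStokesRegularity.NavierStokesRegularity.Theorems.ArgmaxDoors

end
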